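import Summits.BirchSwinnertonDyer.BirchSwinnertonDyer.Theorems.GenusKolyvaginAtTwoGenusPrimitiveSupplyAtTwoOfKernels
import Summits.BirchSwinnertonDyer.BirchSwinnertonDyer.Theorems.GenusKolyvaginAtTwoGenusPrimitiveSupplyAtTwoGenusComponents

/-!
# Route `GenusKolyvaginAtTwo`, crux `GenusPrimitiveSupplyAtTwo` (stmt-BirchSwinnertonDyer-22136), line `genus-supply`:
# the crux BY NAME from PRINT ∧ CONV₂ ∧ SUPPLY ∧ «EXACT GENUS COMPONENT» — a second typed shape for the open kernel

Lead prover seat bsd-line-gk2-p1 (g3). CONDITIONAL; the crux stays OPEN; BSD is not proved by any of this.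

The by-name closer `genusPrimitiveSupplyAtTwo_of_namedFacts_of_twoConverse_of_multiGenus` (g2, `…OfKernels`) takes the open kernel
U in the currency «some multi-genus trace `Z_n = Tr_{K[n]/F_n} y(n)` is not `2`-divisible». With the genus-character decomposition
`2^r Z_n = Σ_{M ⊆ {ℓ∣n}} Y_M` (`…GenusComponents`) the kernel can instead be fed in the currency of the GENUS-CHARACTER HEEGNER POINTS
`Y_M = Σ_{g ∈ 𝒢_n} χ_M(g) g·y(n) ∈ E(K[n])^{χ_M}` — the objects of the explicit Gross–Zagier formula for ring class characters
(Cai–Shu–Tian 2014 Thm 1.1) and of the cell's BSD-side U-LEDGER (♣):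
  (X) «for every habitat `E` and admissible frame, SOME square-free `n` of Kolyvagin primes at `2` and SOME `M₀ ⊆ {ℓ ∣ n}` have every
      other component `Y_M` (`M ≠ M₀`) in `2^{r+1}E(K[n])` and `Y_{M₀} ∉ 2^{r+1}E(K[n])`» (`r = #{ℓ ∣ n}`).
(X) ⟹ U by the gluing-free (R2)-mechanism `exists_two_smul_eq_fixSum_iff_of_forall_ne`; so PRINT ∧ CONV₂ ∧ SUPPLY ∧ (X) ⟹ the crux
(`genusPrimitiveSupplyAtTwo_of_namedFacts_of_twoConverse_of_exactGenusComponent`). At `n = ℓ` prime and `M₀ = {ℓ}`, (X) reads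
«`a_ℓ·y_K′ ∈ 4E(K[ℓ])` and `Y_χ ∉ 4E(K[ℓ])`» (`…ExactnessCriterion`): an exact-`2`-adic-index statement for ONE genus twist. BSD-side
(U-LEDGER (R2), McCallum's level count) (X) is expected exactly at the levels `r =` number of pairs of elementary divisors of
`Ш(E/K)[2^∞]`; it is a SUFFICIENT typed child for U, offered to the pen next to the multi-genus form (evidence #12).
Helper (`--supports stmt-BirchSwinnertonDyer-22136`).
-/

set_option linter.dupNamespace false -- tree convention: `Summit.BirchSwinnertonDyer.BirchSwinnertonDyer.Theorems` (summit = sub-problem)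

noncomputable section

open scoped Classical

namespace Summit.BirchSwinnertonDyer.BirchSwinnertonDyer.Theorems.GenusKoly

open Finset NumberField WeierstrassCurve Literature.NumberTheory.EllipticCurves
  Literature.NumberTheory.EllipticCurves.ModularForms

section Heegner

variable {W : WeierstrassCurve ℚ} [NeZero (W.conductorNorm ℤ)] {K : Type} [Field K] [NumberField K]
  {Dt : ModularParametrizationData W (W.conductorNorm ℤ)} {β : ℤ} {ι : K →+* ℂ}

/-- **Exact genus component ⟹ `2`-primitive multi-genus trace.** On the crux's frame (`ρ̄_{E,2}` onto, `K` imaginary quadratic with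
odd `d_K` and the Heegner hypothesis, `n ≠ 0`), for a datum `d` of conductor `n`, radicals `θ_ℓ`, `G` enumerating `𝒢_n`, `T` enumerating
the `θ`-fixing elements of `𝒢_n`, and `M₀ ⊆ {ℓ ∣ n}`: if every genus component `Y_M`, `M ≠ M₀`, lies in `2^{r+1}E(K[n])` and
`Y_{M₀}` does not, then `Z_n = Σ_{g∈T} g·y(n) ∉ 2E(K[n])`. [cite: GrossLMS1991, §3 (3.5), §4 (4.1), Lemma 4.3] -/
theorem heegner_not_exists_two_zsmul_eq_multiGenusTrace_of_exactComponent [W.IsElliptic] [W.IsGloballyMinimal]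
    (hK : IsImaginaryQuadratic K) (hodd : Odd (NumberField.discr K)) (hH : SatisfiesHeegnerHypothesis (W.conductorNorm ℤ) K)
    (hsurj : W.HasSurjectiveModNGaloisRep ((2 : ℤ) ^ 1)) {n : ℕ} (hn : n ≠ 0) (d : KolyvaginHeegnerData Dt β ι n)
    (θ : ℕ → ringClassField K ι n) (G : Finset (ringClassField K ι n ≃ₐ[ℚ] ringClassField K ι n))
    (hG : ∀ g, g ∈ G ↔ g ∈ ringClassGal ι n) (T : Finset (ringClassField K ι n ≃ₐ[ℚ] ringClassField K ι n))
    (hT : ∀ g, g ∈ T ↔ g ∈ ringClassGal ι n ∧ ∀ ℓ ∈ n.primeFactors, g (θ ℓ) = θ ℓ)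
    {M₀ : Finset ℕ} (hM₀ : M₀ ∈ n.primeFactors.powerset)
    (hdeep : ∀ M ∈ n.primeFactors.powerset, M ≠ M₀ → ∃ Q : (W.baseChange (ringClassField K ι n)).toAffine.Point,
      ((2 : ℤ) ^ (n.primeFactors.card + 1)) • Q =
        ∑ g ∈ G, (∏ ℓ ∈ M, (if g (θ ℓ) = θ ℓ then (1 : ℤ) else -1)) • pointGalHom W (ringClassField K ι n) g d.y)
    (hexact : ¬ ∃ Q : (W.baseChange (ringClassField K ι n)).toAffine.Point, ((2 : ℤ) ^ (n.primeFactors.card + 1)) • Q =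
        ∑ g ∈ G, (∏ ℓ ∈ M₀, (if g (θ ℓ) = θ ℓ then (1 : ℤ) else -1)) • pointGalHom W (ringClassField K ι n) g d.y) :
    ¬ ∃ Q : (W.baseChange (ringClassField K ι n)).toAffine.Point, (2 : ℤ) • Q =
      ∑ g ∈ T, pointGalHom W (ringClassField K ι n) g d.y := by
  have hTeq : T = G.filter (fun g ↦ ∀ ℓ ∈ n.primeFactors, g (θ ℓ) = θ ℓ) := by
    ext g
    rw [hT, Finset.mem_filter, hG]
  rw [hTeq, exists_two_smul_eq_fixSum_iff_of_forall_ne (pointGalHom W (ringClassField K ι n))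
    (heegner_two_torsion_free (ι := ι) hK hodd hH hsurj hn) G n.primeFactors (fun ℓ g ↦ g (θ ℓ) = θ ℓ) d.y hM₀ hdeep]
  exact hexact

end Heegner

/-- **THE CRUX BY NAME FROM PRINT ∧ (CONV₂) ∧ SUPPLY ∧ (X) «EXACT GENUS COMPONENT».** Named print facts `exists_isNewformOf` (BCDT),
`p_parity · 2` (Dokchitser–Dokchitser), `exists_casselsTate_pairing` (Cassels), `MazurRubin2010.prop52_rat` (Mazur–Rubin 2010 Prop. 5.2),
`gross_zagier` (Gross–Zagier); (CONV₂) the rank-one `2`-converse for non-CM curves (= crux 19220 widened) — OPEN; (X) in binder form: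
on the habitat, for every admissible frame, some square-free `n` of Kolyvagin primes at `2`, radicals `θ`, an enumeration `G` of
`Gal(K[n]/K)` and some `M₀ ⊆ {ℓ∣n}` with all genus-character components `Y_M` (`M ≠ M₀`) in `2^{r+1}E(K[n])` and `Y_{M₀} ∉ 2^{r+1}E(K[n])`
— OPEN (an exact `2`-adic Heegner-index statement for one genus twist `E^{(m₀*)}/K`; W. Zhang's theorem at `p = 2` in genus form).
CONDITIONAL; nothing is closed. [cite: GrossLMS1991, §3 (3.5), Prop. 3.7 (1), §4 (4.1)] [cite: GrossZagier1986, Thm. I.6.3]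
[cite: DokchitserDokchitserAnnals2010, Thm. 1.4] [cite: MazurRubin2010, Prop. 5.2] [cite: McCallumLMS1991, §5] -/
theorem genusPrimitiveSupplyAtTwo_of_namedFacts_of_twoConverse_of_exactGenusComponent (hmod : exists_isNewformOf)
    (hpar : ∀ V : WeierstrassCurve ℚ, p_parity V 2) (hCT : exists_casselsTate_pairing (K := ℚ))
    (hMR : Literature.NumberTheory.EllipticCurves.MazurRubin2010.prop52_rat)
    (hGZ : ∀ (W : WeierstrassCurve ℚ) [NeZero (W.conductorNorm ℤ)] (K : Type) [Field K] [NumberField K],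
      gross_zagier (W.conductorNorm ℤ) W K)
    (hconv : ∀ (V : WeierstrassCurve ℚ) [V.IsElliptic] [V.IsGloballyMinimal],
      ¬ V.HasCM → V.selmerCorank 2 = 1 → V.analyticRank = 1)
    (hX : ∀ (W : WeierstrassCurve ℚ) [W.IsElliptic] [W.IsGloballyMinimal] [NeZero (W.conductorNorm ℤ)],
      ¬ W.HasCM → W.analyticRank = 0 → (∀ n : ℕ, 0 < n → W.HasSurjectiveModNGaloisRep ((2 : ℤ) ^ n)) →
      Odd W.tamagawaProduct →
      ∀ (K : Type) [Field K] [NumberField K],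
      IsImaginaryQuadratic K → Odd (NumberField.discr K) → NumberField.discr K ≠ -3 →
      SatisfiesHeegnerHypothesis (W.conductorNorm ℤ) K →
      ¬ IsSquare ((NumberField.discr K : ℚ) * -|W.Δ|) → ¬ IsSquare ((NumberField.discr K : ℚ) * (-(2 * |W.Δ|))) →
      ∀ (Dt : ModularParametrizationData W (W.conductorNorm ℤ)),
      (∀ z ∈ Dt.L.lattice, ∃ w ∈ periodLattice Dt.f, z = (Dt.c : ℂ) * w) → Odd Dt.c →
      ∀ (β : ℤ) (ι : K →+* ℂ) (d₁ : KolyvaginHeegnerData Dt β ι 1), ¬ IsOfFinAddOrder d₁.derivedPoint →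
      ∀ (Wd : WeierstrassCurve ℚ) [Wd.IsElliptic] [Wd.IsGloballyMinimal],
      (∃ C : WeierstrassCurve.VariableChange ℚ, C • W.quadraticTwist (NumberField.discr K : ℚ) = Wd) →
      Wd.analyticRank = 1 → Nat.card (Wd.selmerGroup 2) = 2 →
      ∃ (n : ℕ) (d : KolyvaginHeegnerData Dt β ι n) (θ : ℕ → ringClassField K ι n)
        (G : Finset (ringClassField K ι n ≃ₐ[ℚ] ringClassField K ι n)) (M₀ : Finset ℕ), Squarefree n ∧
        (∀ ℓ ∈ n.primeFactors, Zhang2014.IsKolyvaginPrime (W.conductorNorm ℤ) W K 2 ℓ) ∧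
        (∀ ℓ ∈ n.primeFactors, θ ℓ ^ 2 = algebraMap ℚ (ringClassField K ι n) ((-1 : ℚ) ^ (ℓ / 2) * ℓ)) ∧
        (∀ g, g ∈ G ↔ g ∈ ringClassGal ι n) ∧ M₀ ∈ n.primeFactors.powerset ∧
        (∀ M ∈ n.primeFactors.powerset, M ≠ M₀ → ∃ Q : (W.baseChange (ringClassField K ι n)).toAffine.Point,
          ((2 : ℤ) ^ (n.primeFactors.card + 1)) • Q =
            ∑ g ∈ G, (∏ ℓ ∈ M, (if g (θ ℓ) = θ ℓ then (1 : ℤ) else -1)) • pointGalHom W (ringClassField K ι n) g d.y) ∧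
        ¬ ∃ Q : (W.baseChange (ringClassField K ι n)).toAffine.Point, ((2 : ℤ) ^ (n.primeFactors.card + 1)) • Q =
          ∑ g ∈ G, (∏ ℓ ∈ M₀, (if g (θ ℓ) = θ ℓ then (1 : ℤ) else -1)) • pointGalHom W (ringClassField K ι n) g d.y) :
    Summit.BirchSwinnertonDyer.BirchSwinnertonDyer.Theses.GenusKolyvaginAtTwo.GenusPrimitiveSupplyAtTwo := by
  refine genusPrimitiveSupplyAtTwo_of_namedFacts_of_twoConverse_of_multiGenus hmod hpar hCT hMR hGZ hconv ?_
  intro W _ _ _ hcm hr0 hρ hT K _ _ hIQ hodd h3 hHe hsq1 hsq2 Dt hoptDt hc β ι d₁ hy Wd _ _ hWd hrd hSel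
  obtain ⟨n, d, θ, G, M₀, hn, hKoly, hθ, hG, hM₀, hdeep, hexact⟩ :=
    hX W hcm hr0 hρ hT K hIQ hodd h3 hHe hsq1 hsq2 Dt hoptDt hc β ι d₁ hy Wd hWd hrd hSel
  refine ⟨n, d, θ, G.filter (fun g ↦ ∀ ℓ ∈ n.primeFactors, g (θ ℓ) = θ ℓ), hn, hKoly, hθ,
    fun g ↦ by rw [Finset.mem_filter, hG], ?_⟩
  exact heegner_not_exists_two_zsmul_eq_multiGenusTrace_of_exactComponent hIQ hodd hHe (by simpa using hρ 1 one_pos)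
    hn.ne_zero d θ G hG _ (fun g ↦ by rw [Finset.mem_filter, hG]) hM₀ hdeep hexact

end Summit.BirchSwinnertonDyer.BirchSwinnertonDyer.Theorems.GenusKoly

end
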